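import Mathlib

/-!
# Strict `ℓ¹` loss under a discordant merge (stub `stub_l1Strict`)

The stub `stub_l1Strict` of the crux `MobiusLadder.QuadraticDigitPhases`
(stmt-QuantumAdvantage-1391), line `Sketch`, with its lemmas.  Mathlib only.

Row vectors `v` are contracted in `ℓ¹` by a matrix `A` whose rows have absolute sums `≤ 1`:
`‖v A‖₁ ≤ ‖v‖₁`.  If moreover two distinct states `x ≠ x'` send contributions `v x * A x y` and
`v x' * A x' y` of opposite strict signs to the same state `y` (a *discordant merge*), these two
contributions cancel partly and the contraction is strict: `‖v A‖₁ < ‖v‖₁`.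

Proof: `|(v A) z| = |∑ s, v s * A s z| ≤ ∑ s, |v s * A s z|` for every `z`, strictly at `z = y`
(split off the two summands `s = x, x'` and use `|a + b| < |a| + |b|` for `a * b < 0`); summing
over `z` and exchanging the sums gives `∑ s, |v s| * ∑ z, |A s z| ≤ ∑ s, |v s|`.
-/

set_option linter.dupNamespace false -- D-0017: single-problem summit ⇒ `QuantumAdvantage.QuantumAdvantage` by design

namespace Summit.QuantumAdvantage.QuantumAdvantage.Theorems.MobiusLadderQuadraticDigitPhasesStubL1Strict

open Finset
open scoped Matrix

/-- Two reals of opposite strict signs cancel partly: `|a + b| < |a| + |b|` when `a * b < 0`. -/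
theorem abs_add_lt_of_mul_neg {a b : ℝ} (h : a * b < 0) : |a + b| < |a| + |b| := by
  rcases mul_neg_iff.mp h with ⟨ha, hb⟩ | ⟨ha, hb⟩
  · rw [abs_of_pos ha, abs_of_neg hb, abs_lt]
    constructor <;> linarith
  · rw [abs_of_neg ha, abs_of_pos hb, abs_lt]
    constructor <;> linarith

/-- A finite sum with two summands of opposite strict signs is strictly smaller in absolute value
than the sum of the absolute values. -/
theorem abs_sum_lt_sum_abs {ι : Type*} [DecidableEq ι] (s : Finset ι) (f : ι → ℝ) {a b : ι}
    (ha : a ∈ s) (hb : b ∈ s) (hab : a ≠ b) (h : f a * f b < 0) :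
    |∑ i ∈ s, f i| < ∑ i ∈ s, |f i| := by
  have hb' : b ∈ s.erase a := mem_erase.mpr ⟨hab.symm, hb⟩
  rw [← add_sum_erase s f ha, ← add_sum_erase s (fun i => |f i|) ha,
    ← add_sum_erase _ f hb', ← add_sum_erase _ (fun i => |f i|) hb', ← add_assoc, ← add_assoc]
  calc |f a + f b + ∑ i ∈ (s.erase a).erase b, f i|
      ≤ |f a + f b| + |∑ i ∈ (s.erase a).erase b, f i| := abs_add_le _ _
    _ < |f a| + |f b| + ∑ i ∈ (s.erase a).erase b, |f i| :=
        add_lt_add_of_lt_of_le (abs_add_lt_of_mul_neg h) (abs_sum_le_sum_abs _ _)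

/-- STUB `stub_l1Strict`: strict `ℓ¹` loss under a discordant merge.  If the rows of `A` have
absolute sums `≤ 1` and two distinct states `x ≠ x'` send contributions of opposite strict signs
to the same state `y`, then `‖v A‖₁ < ‖v‖₁`. -/
theorem stub_l1Strict :
    ∀ (ι : Type) [Fintype ι] (A : Matrix ι ι ℝ) (v : ι → ℝ) (y x x' : ι),
      (∀ s : ι, ∑ z : ι, |A s z| ≤ 1) → x ≠ x' → v x * A x y * (v x' * A x' y) < 0 →
        ∑ z : ι, |(v ᵥ* A) z| < ∑ s : ι, |v s| := by
  intro ι _ A v y x x' hA hxx' hneg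
  classical
  calc ∑ z, |(v ᵥ* A) z| = ∑ z, |∑ s, v s * A s z| := rfl
    _ < ∑ z, ∑ s, |v s * A s z| :=
        sum_lt_sum (fun z _ => abs_sum_le_sum_abs _ _)
          ⟨y, mem_univ _, abs_sum_lt_sum_abs univ (fun s => v s * A s y) (mem_univ x)
            (mem_univ x') hxx' hneg⟩
    _ = ∑ s, |v s| * ∑ z, |A s z| := by
        rw [sum_comm]; simp_rw [mul_sum, ← abs_mul]
    _ ≤ ∑ s, |v s| := sum_le_sum fun s _ =>
        (mul_le_mul_of_nonneg_left (hA s) (abs_nonneg _)).trans_eq (mul_one _)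

end Summit.QuantumAdvantage.QuantumAdvantage.Theorems.MobiusLadderQuadraticDigitPhasesStubL1Strict
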